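import Summits.QuantumFields.YangMills.Theorems.BalabanUVNodesN15KingModelCurvaturePlaquette
import HarnessLib

/-!
# BalabanUVNodes ∕ N15 — THE KING-MODEL RUNG (PART Ϳ-d): π-FLUX IS EXACT — at the `ℤ₂` field with plaquette `−1` in the `(ν₀,ν₁)`-planes (any fibre `𝕜ⁿ`, `𝕜 = ℝ` or `ℂ`) the bottom of
# King's covariant kinetic spectrum is `λ_min(−cΔ_U) = (4 − 2√2)·c` EXACTLY: Ϳ-b's plaquette bound `2c·λ(−1) = 2c(2−√2)` is ATTAINED by the explicit sublattice eigenvector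
# `v(x) = ((1+√2) + (−1)^{x_{ν₀}})·e` — the plaquette coercivity constant is sharp
# (Track A, DAG node N15 = NE2; FAN-OUT v1.1 §N15 s3 «KING-MODEL RUNG … + what the curved case adds»; count-neutral)

HONEST FRAMING.  Count-neutral (cell `pub-ymgap`, seat `pub-ymgap-dag-n15-e` g46; `--supports stmt-QuantumFields-27247 --as helper` = K3ᴬ, KEY MAP v3).  King's fine covariance layer
`−cΔ_U+m²` (Ͱ-a `covLapF`) at one explicit `ℤ₂` link field on ONE finite torus; elementary; NOT Bałaban's `G_k(U)`; NOT [Balaban1985BackgroundPropagators] (3.42); NOT a node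
discharge (N15 of record untouched); nothing continuum ∕ ℝ⁴ ∕ OS ∕ Clay.

THE OBJECT.  `subSgn ν₀ x = (−1)^{x_{ν₀}}` (the sublattice sign along `ν₀`; a character of `ℤ∕K_{ν₀}` when `K_{ν₀}` is EVEN) and the π-FLUX FIELD `piFluxLink ν₀ ν₁ (x,μ) = subSgn ν₀ x·1` on the
`ν₁`-links, `1` elsewhere — a `ℤ₂ ⊂ U(1) ⊂ U(n)` lattice gauge field (real: it acts on REAL fields too), the Landau gauge of a magnetic flux `π` through every `(ν₀,ν₁)`-plaquette:
`P_U(x,ν₀,ν₁) = −1` at every site (`K_{ν₀}` even; `kingPlaq_piFlux`).  (For `𝕜 = ℂ`, `n = 1` it is Ͻ-q's `fluxLink K ((K_{ν₀}∕2)e_{ν₀}) ν₁`, angle `p′ = π`; here typed directly so that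
real scalars and every fibre are covered.)
THE RESULTS (`K_{ν₀}` even, `ν₀ ≠ ν₁`, `c ≥ 0`, any `m²`, any fibre):
* §1 the sign calculus: `neg_one_pow_mod_of_even`, `subSgn_mul_self`, ★ `subSgn_add_unitVec_self`∕`subSgn_sub_unitVec_self` (`subSgn(x ± e_{ν₀}) = −subSgn x`, needs `K_{ν₀}` even — on an odd cycle the
  sign has a defect), `subSgn_add_unitVec_of_ne`∕`subSgn_sub_unitVec_of_ne`, `star_subSgn`, `piFluxLink_mem_unitaryGroup`, ★★ **`kingPlaq_piFlux`** (`P = −1`);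
* §2 ★★★ **`re_quadForm_covLapF_piFlux_ge`** — `(m² + (4−2√2)c)·Σ_x‖v_x‖² ≤ Re⟨v,(−cΔ_U+m²)v⟩` (Ϳ-b at `γ = −1`: `Re⟪u,(−1)u⟫ = −‖u‖²`, `λ(−1) = 2−√2`), ★★ `eigenvalues_covLapF_piFlux_ge`;
* §3 ★★★ **`covLapF_piFlux_mulVec_piTrial`** — THE BOUND IS ATTAINED: `piTrial e (x,i) = ((1+√2) + subSgn x)·e_i` (`2+√2` on the even, `√2` on the odd `ν₀`-sublattice, constant along the
  other directions) satisfies `(−cΔ_U+m²)v = (m² + (4−2√2)c)·v` EXACTLY (King's stencil Ͱ-a `covLapF_mulVec_apply`: the `ν₀`-bonds see the opposite sublattice, the `ν₁`-bonds the sign,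
  the other `d−1` directions nothing; the algebra closes on `(4−2√2)(1+√2) = 2√2`); `piTrial_ne_zero`; ★★★ **`exists_eigenvalue_covLapF_piFlux_eq`** + **`piFlux_spectral_bottom`** —
  `min spec(−cΔ_U+m²) = m² + (4−2√2)c`: SOME eigenvalue equals it and ALL are `≥` it; so Ϳ-b's constant `2c·plaqGap(−1)` cannot be improved.
WHAT THE CURVED CASE ADDS (as theorems): the maximal abelian curvature per plaquette (`P = −1`) gives King's massless covariant Laplacian the mass `(4−2√2)c ≈ 1.17c = 1.17η⁻²` — of the
order of the cutoff, volume-independent, for every fibre and even for real fields; and the plaquette road of PART Ϳ is sharp there.  (π-flux ∕ «fully frustrated» hopping is the setting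
of [LiebLoss1993Fluxes]-type flux-phase problems; nothing from that literature is used or claimed — notion only.)
PRIOR TREE ART (by name, not restated): Ϳ-a (`plaqGap`, `plaqGap_neg_one`), Ϳ-b (`re_quadForm_covLapF_ge_plaq`, `eigenvalues_covLapF_ge_plaq`), Ͱ-a (`covLapF`, `covLapF_mulVec_apply`,
`isHermitian_covLapF`), Ͱ-b (`fib`), Ͻ-q (`kingPlaq`), Mathlib (`IsHermitian.spectrum_eq_image_range`, `spectrum.mem_iff`, `Matrix.mulVec_injective_iff_isUnit`, `Real.sq_sqrt`).  Dedup (rg at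
filing): basename 0 files; needles `piFluxLink|piTrial|kingPlaq_piFlux|covLapF_piFlux_mulVec_piTrial|piFlux_spectral_bottom|subSgn_add_unitVec_self` 0 tree files.  Locators: [tHooft1979Flux] NPB 153
(flux ∕ twisted sectors, notion only); [DodziukMathai2006] §1 Cor 1.3; [King1986] (2.12) p.653, (4.4) p.670; [Balaban1985BackgroundPropagators] (3.23) p.394.  0 `sorry`, 3 `def`.
-/

noncomputable section
open scoped BigOperators ComplexConjugate ComplexOrder InnerProductSpace
open Finset Matrix WithLp

namespace Summit.QuantumFields.YangMills.BalabanUVNodes.N15KingModelRung.Curvature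

open Literature.MathematicalPhysics.QuantumFieldTheory.Balaban1983to89.B5Prop11Plancherel (Tor unitVec)
open Summit.QuantumFields.YangMills.BalabanUVNodes.N15KingModelRung.Covariant (covLapF covLapF_mulVec_apply fib fib_apply isHermitian_covLapF)
open Summit.QuantumFields.YangMills.BalabanUVNodes.N15KingModelRung.Cover (kingPlaq)

variable {d : ℕ} (K : Fin (d + 1) → ℕ)
variable {𝕜 : Type*} [RCLike 𝕜] {n : Type*} [Fintype n] [DecidableEq n]

/-! ## §1 The sublattice sign and the π-flux field -/

section Sign

omit [Fintype n] [DecidableEq n] in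
/-- `(−1)^{m mod K} = (−1)^m` for EVEN `K`. [folklore] -/
theorem neg_one_pow_mod_of_even {Kν : ℕ} (hK : Even Kν) (m : ℕ) : ((-1 : 𝕜)) ^ (m % Kν) = (-1) ^ m := by
  conv_rhs => rw [← Nat.div_add_mod m Kν, pow_add, pow_mul, hK.neg_one_pow, one_pow, one_mul]

/-- THE SUBLATTICE SIGN along `ν₀`: `subSgn x = (−1)^{x_{ν₀}}` (`x_{ν₀}` read in `{0,…,K_{ν₀}−1}`). [folklore] -/
def subSgn (ν₀ : Fin (d + 1)) (x : Tor K) : 𝕜 := (-1) ^ (x ν₀).val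

omit [Fintype n] [DecidableEq n] in
/-- `subSgn x · subSgn x = 1`. [folklore] -/
theorem subSgn_mul_self (ν₀ : Fin (d + 1)) (x : Tor K) : subSgn K (𝕜 := 𝕜) ν₀ x * subSgn K ν₀ x = 1 := by
  rw [subSgn, ← pow_add, ← two_mul, pow_mul, neg_one_sq, one_pow]

omit [Fintype n] [DecidableEq n] in
/-- `subSgn` is real: `star (subSgn x) = subSgn x`. [folklore] -/
theorem star_subSgn (ν₀ : Fin (d + 1)) (x : Tor K) : star (subSgn K (𝕜 := 𝕜) ν₀ x) = subSgn K ν₀ x := by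
  rw [subSgn, star_pow, star_neg, star_one]

omit [Fintype n] [DecidableEq n] in
/-- `‖subSgn x‖ = 1`. [folklore] -/
theorem norm_subSgn (ν₀ : Fin (d + 1)) (x : Tor K) : ‖subSgn K (𝕜 := 𝕜) ν₀ x‖ = 1 := by
  rw [subSgn, norm_pow, norm_neg, norm_one, one_pow]

variable [hK : ∀ μ, NeZero (K μ)]

omit [Fintype n] [DecidableEq n] in
/-- ★ ON AN EVEN CYCLE THE SIGN ALTERNATES: `subSgn(x + e_{ν₀}) = −subSgn x` (`K_{ν₀}` even; the wrap `K_{ν₀}−1 ↦ 0` is odd ↦ even). [folklore] -/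
theorem subSgn_add_unitVec_self {ν₀ : Fin (d + 1)} (hK2 : Even (K ν₀)) (x : Tor K) : subSgn K (𝕜 := 𝕜) ν₀ (x + unitVec K ν₀) = -subSgn K ν₀ x := by
  have h2 : 2 ≤ K ν₀ := by
    obtain ⟨r, hr⟩ := hK2
    have := Nat.pos_of_ne_zero (NeZero.ne (K ν₀))
    omega
  haveI : Fact (1 < K ν₀) := ⟨by omega⟩
  simp only [subSgn, Pi.add_apply, unitVec, Pi.single_eq_same]
  rw [ZMod.val_add, ZMod.val_one, neg_one_pow_mod_of_even hK2, pow_succ, mul_neg_one]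

omit [Fintype n] [DecidableEq n] in
/-- `subSgn(x − e_{ν₀}) = −subSgn x` (`K_{ν₀}` even). [folklore] -/
theorem subSgn_sub_unitVec_self {ν₀ : Fin (d + 1)} (hK2 : Even (K ν₀)) (x : Tor K) : subSgn K (𝕜 := 𝕜) ν₀ (x - unitVec K ν₀) = -subSgn K ν₀ x := by
  have h := subSgn_add_unitVec_self K (𝕜 := 𝕜) hK2 (x - unitVec K ν₀)
  rw [sub_add_cancel] at h
  rw [h, neg_neg]

omit [Fintype n] [DecidableEq n] hK in
/-- The sign ignores the other coordinates: `subSgn(x + e_μ) = subSgn x` for `μ ≠ ν₀`. [folklore] -/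
theorem subSgn_add_unitVec_of_ne {ν₀ μ : Fin (d + 1)} (hμ : μ ≠ ν₀) (x : Tor K) : subSgn K (𝕜 := 𝕜) ν₀ (x + unitVec K μ) = subSgn K ν₀ x := by
  simp only [subSgn, Pi.add_apply, unitVec, Pi.single_eq_of_ne (Ne.symm hμ), add_zero]

omit [Fintype n] [DecidableEq n] hK in
/-- `subSgn(x − e_μ) = subSgn x` for `μ ≠ ν₀`. [folklore] -/
theorem subSgn_sub_unitVec_of_ne {ν₀ μ : Fin (d + 1)} (hμ : μ ≠ ν₀) (x : Tor K) : subSgn K (𝕜 := 𝕜) ν₀ (x - unitVec K μ) = subSgn K ν₀ x := by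
  simp only [subSgn, Pi.sub_apply, unitVec, Pi.single_eq_of_ne (Ne.symm hμ), sub_zero]

/-- THE π-FLUX FIELD: `U(x,ν₁) = subSgn_{ν₀}(x)·1`, all other links `1` — the Landau gauge of a flux `π` through every `(ν₀,ν₁)`-plaquette; a `ℤ₂` gauge field acting on any fibre.
[cite: tHooft1979Flux, NPB 153 (flux sectors, notion); King1986, (2.12) p.653] -/
def piFluxLink (ν₀ ν₁ : Fin (d + 1)) : Tor K × Fin (d + 1) → Matrix n n 𝕜 := fun b => if b.2 = ν₁ then (subSgn K ν₀ b.1 : 𝕜) • (1 : Matrix n n 𝕜) else 1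

omit hK in
/-- The links are unitary (`(s·1)^*(s·1) = s̄s·1 = 1`). [folklore] -/
theorem piFluxLink_mem_unitaryGroup (ν₀ ν₁ : Fin (d + 1)) (b : Tor K × Fin (d + 1)) : piFluxLink K (n := n) (𝕜 := 𝕜) ν₀ ν₁ b ∈ Matrix.unitaryGroup n 𝕜 := by
  unfold piFluxLink
  split_ifs
  · refine Matrix.mem_unitaryGroup_iff'.mpr ?_
    rw [star_eq_conjTranspose, conjTranspose_smul, conjTranspose_one, smul_mul_smul, Matrix.one_mul, star_subSgn, subSgn_mul_self, one_smul]
  · exact Submonoid.one_mem _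

omit [Fintype n] hK in
/-- `U(x,μ) = 1` for `μ ≠ ν₁`; `U(x,ν₁) = subSgn x·1`. [folklore] -/
theorem piFluxLink_apply_of_ne {ν₀ ν₁ μ : Fin (d + 1)} (hμ : μ ≠ ν₁) (x : Tor K) : piFluxLink K (n := n) (𝕜 := 𝕜) ν₀ ν₁ (x, μ) = 1 := by
  unfold piFluxLink; rw [if_neg hμ]
omit [Fintype n] hK in
/-- `U(x,ν₁) = subSgn x·1`. [folklore] -/
theorem piFluxLink_apply_self (ν₀ ν₁ : Fin (d + 1)) (x : Tor K) : piFluxLink K (n := n) (𝕜 := 𝕜) ν₀ ν₁ (x, ν₁) = (subSgn K ν₀ x : 𝕜) • (1 : Matrix n n 𝕜) := by simp [piFluxLink]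

/-- ★★ **EVERY `(ν₀,ν₁)`-PLAQUETTE IS `−1`** (`K_{ν₀}` even, `ν₀ ≠ ν₁`): `1·(subSgn(x+e_{ν₀})·1)·1·(subSgn(x)·1)^* = −subSgn(x)²·1 = −1`. [cite: King1986, (2.12) p.653; tHooft1979Flux, NPB 153 (flux sectors, notion)] -/
theorem kingPlaq_piFlux {ν₀ ν₁ : Fin (d + 1)} (hK2 : Even (K ν₀)) (hν : ν₀ ≠ ν₁) (x : Tor K) : kingPlaq K (piFluxLink K (n := n) (𝕜 := 𝕜) ν₀ ν₁) x ν₀ ν₁ = -1 := by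
  rw [kingPlaq, piFluxLink_apply_of_ne K hν, piFluxLink_apply_self, piFluxLink_apply_of_ne K hν, piFluxLink_apply_self, subSgn_add_unitVec_self K hK2,
    conjTranspose_one, conjTranspose_smul, conjTranspose_one, star_subSgn, Matrix.one_mul, Matrix.mul_one, smul_mul_smul, Matrix.one_mul, neg_mul, subSgn_mul_self, neg_smul, one_smul]

end Sign

/-! ## §2 The lower bound `m² + (4 − 2√2)c` -/

section Lower

variable [hK : ∀ μ, NeZero (K μ)] {c : ℝ}

omit hK in
/-- The numerical range of `−1`: `Re⟪u, (−1)u⟫ = −‖u‖²` (so `γ = −1` in Ϳ-b, with equality). [folklore] -/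
theorem re_inner_toEuclideanLin_neg_one (u : EuclideanSpace 𝕜 n) : RCLike.re ⟪u, Matrix.toEuclideanLin (-1 : Matrix n n 𝕜) u⟫_𝕜 = (-1) * ‖u‖ ^ 2 := by
  have h : Matrix.toEuclideanLin (-1 : Matrix n n 𝕜) u = -u := by
    have h1 : Matrix.toEuclideanLin (1 : Matrix n n 𝕜) u = u := by rw [Matrix.toLpLin_apply, Matrix.one_mulVec]
    rw [map_neg, LinearMap.neg_apply, h1]
  rw [h, inner_neg_right, map_neg, inner_self_eq_norm_sq_to_K]
  rw [show ((‖u‖ : 𝕜) ^ 2) = (((‖u‖ ^ 2 : ℝ)) : 𝕜) by push_cast; ring, RCLike.ofReal_re]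
  ring

/-- `2·λ(−1) = 4 − 2√2`. [folklore] -/
theorem two_mul_plaqGap_neg_one : 2 * plaqGap (-1) = 4 - 2 * Real.sqrt 2 := by rw [plaqGap_neg_one]; ring

/-- ★★★ **π-FLUX LOWER BOUND**: `(m² + (4−2√2)c)·Σ_x‖v_x‖² ≤ Re⟨v, (−cΔ_U+m²)v⟩` at the π-flux field (`K_{ν₀}` even, `ν₀ ≠ ν₁`, `c ≥ 0`, any fibre) — Ϳ-b's plaquette coercivity at
`γ = −1`. [cite: DodziukMathai2006, Cor 1.3 §1; King1986, (4.4) p.670; Balaban1985BackgroundPropagators, (3.23) p.394] -/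
theorem re_quadForm_covLapF_piFlux_ge (hc : 0 ≤ c) (m2 : ℝ) {ν₀ ν₁ : Fin (d + 1)} (hK2 : Even (K ν₀)) (hν : ν₀ ≠ ν₁) (v : Tor K × n → 𝕜) :
    (m2 + (4 - 2 * Real.sqrt 2) * c) * ∑ x, ‖fib K v x‖ ^ 2 ≤ RCLike.re (star v ⬝ᵥ (covLapF K c m2 (piFluxLink K ν₀ ν₁) *ᵥ v)) := by
  have h := re_quadForm_covLapF_ge_plaq K hc m2 (piFluxLink_mem_unitaryGroup K ν₀ ν₁) hν (γ := -1)
    (fun x u => by rw [kingPlaq_piFlux K (n := n) (𝕜 := 𝕜) hK2 hν x, re_inner_toEuclideanLin_neg_one]) v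
  have hcoef : 2 * c * plaqGap (-1) = (4 - 2 * Real.sqrt 2) * c := by rw [mul_right_comm, two_mul_plaqGap_neg_one]
  rwa [hcoef] at h

/-- ★★ Every eigenvalue of `−cΔ_U+m²` at the π-flux field is `≥ m² + (4−2√2)c`. [cite: DodziukMathai2006, Cor 1.3 §1; King1986, (4.4) p.670] -/
theorem eigenvalues_covLapF_piFlux_ge (hc : 0 ≤ c) (m2 : ℝ) {ν₀ ν₁ : Fin (d + 1)} (hK2 : Even (K ν₀)) (hν : ν₀ ≠ ν₁) (i : Tor K × n) :
    m2 + (4 - 2 * Real.sqrt 2) * c ≤ (isHermitian_covLapF K c m2 (piFluxLink K (n := n) (𝕜 := 𝕜) ν₀ ν₁)).eigenvalues i := by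
  have h := eigenvalues_covLapF_ge_plaq K hc m2 (piFluxLink_mem_unitaryGroup K ν₀ ν₁) hν (γ := -1)
    (fun x u => by rw [kingPlaq_piFlux K (n := n) (𝕜 := 𝕜) hK2 hν x, re_inner_toEuclideanLin_neg_one]) i
  have hcoef : 2 * c * plaqGap (-1) = (4 - 2 * Real.sqrt 2) * c := by rw [mul_right_comm, two_mul_plaqGap_neg_one]
  rwa [hcoef] at h

end Lower

/-! ## §3 The bound is attained: the sublattice eigenvector -/

section Attained

variable [hK : ∀ μ, NeZero (K μ)] {c : ℝ}

/-- THE TRIAL VECTOR `v(x,i) = ((1+√2) + subSgn x)·e_i`: `2+√2` on the even and `√2` on the odd `ν₀`-sublattice, a fixed fibre vector `e`, constant along all other directions. [folklore] -/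
def piTrial (ν₀ : Fin (d + 1)) (e : n → 𝕜) : Tor K × n → 𝕜 := fun p => ((((1 + Real.sqrt 2 : ℝ)) : 𝕜) + subSgn K ν₀ p.1) * e p.2

/-- `(s·1)·w = s·w` componentwise. [folklore] -/
theorem smul_one_mulVec_apply (s : 𝕜) (w : n → 𝕜) (i : n) : ((s • (1 : Matrix n n 𝕜)) *ᵥ w) i = s * w i := by
  rw [Matrix.smul_mulVec, Matrix.one_mulVec, Pi.smul_apply, smul_eq_mul]

/-- ★★★ **THE π-FLUX EIGENVECTOR**: `(−cΔ_U+m²)·piTrial = (m² + (4−2√2)c)·piTrial` EXACTLY (`K_{ν₀}` even, `ν₀ ≠ ν₁`): by King's stencil the `ν₀`-neighbours carry the opposite sign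
`((1+√2) − s)`, the two `ν₁`-bonds the factor `s`, the other `d−1` directions cancel against the diagonal; with `s² = 1` the identity reduces to `(4−2√2)(1+√2) = 2√2`.
[cite: King1986, (4.4) p.670; Balaban1985BackgroundPropagators, (3.23) p.394; tHooft1979Flux, NPB 153 (flux sectors, notion)] -/
theorem covLapF_piFlux_mulVec_piTrial (c m2 : ℝ) {ν₀ ν₁ : Fin (d + 1)} (hK2 : Even (K ν₀)) (hν : ν₀ ≠ ν₁) (e : n → 𝕜) :
    covLapF K c m2 (piFluxLink K ν₀ ν₁) *ᵥ piTrial K ν₀ e = (((m2 + (4 - 2 * Real.sqrt 2) * c : ℝ)) : 𝕜) • piTrial K ν₀ e := by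
  funext ⟨x, i⟩
  rw [covLapF_mulVec_apply, Pi.smul_apply, smul_eq_mul]
  -- split the direction sum into ν₀, ν₁ and the rest
  have hsplit : ∀ f : Fin (d + 1) → 𝕜, ∑ μ, f μ = f ν₀ + f ν₁ + ∑ μ ∈ (Finset.univ.erase ν₀).erase ν₁, f μ := fun f => by
    rw [← Finset.add_sum_erase _ _ (Finset.mem_univ ν₀), ← Finset.add_sum_erase _ _ (Finset.mem_erase.mpr ⟨Ne.symm hν, Finset.mem_univ ν₁⟩), add_assoc]
  rw [hsplit]
  -- the generic directions μ ∉ {ν₀, ν₁}: `U = 1`, the trial vector is unchanged ⟹ each contributes `2·v(x,i)`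
  have hrest : ∑ μ ∈ (Finset.univ.erase ν₀).erase ν₁,
      (((piFluxLink K ν₀ ν₁ (x, μ)) *ᵥ fun j => piTrial K ν₀ e (x + unitVec K μ, j)) i
        + (((piFluxLink K ν₀ ν₁ (x - unitVec K μ, μ)))ᴴ *ᵥ fun j => piTrial K ν₀ e (x - unitVec K μ, j)) i)
      = (((d : ℝ) - 1 : ℝ) : 𝕜) * (2 * piTrial K ν₀ e (x, i)) := by
    have hterm : ∀ μ ∈ (Finset.univ.erase ν₀).erase ν₁,
        (((piFluxLink K ν₀ ν₁ (x, μ)) *ᵥ fun j => piTrial K ν₀ e (x + unitVec K μ, j)) i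
          + (((piFluxLink K ν₀ ν₁ (x - unitVec K μ, μ)))ᴴ *ᵥ fun j => piTrial K ν₀ e (x - unitVec K μ, j)) i) = 2 * piTrial K ν₀ e (x, i) := by
      intro μ hμ
      have hμ1 : μ ≠ ν₁ := Finset.ne_of_mem_erase hμ
      have hμ0 : μ ≠ ν₀ := Finset.ne_of_mem_erase (Finset.mem_of_mem_erase hμ)
      rw [piFluxLink_apply_of_ne K hμ1, piFluxLink_apply_of_ne K hμ1, conjTranspose_one, Matrix.one_mulVec, Matrix.one_mulVec]
      simp only [piTrial, subSgn_add_unitVec_of_ne K hμ0, subSgn_sub_unitVec_of_ne K hμ0]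
      ring
    rw [Finset.sum_congr rfl hterm, Finset.sum_const]
    have hcard : ((Finset.univ.erase ν₀).erase ν₁).card = d - 1 := by
      rw [Finset.card_erase_of_mem (Finset.mem_erase.mpr ⟨Ne.symm hν, Finset.mem_univ ν₁⟩), Finset.card_erase_of_mem (Finset.mem_univ ν₀), Finset.card_univ, Fintype.card_fin]
      omega
    have hd1 : 1 ≤ d := by
      by_contra h0
      have : d = 0 := by omega
      subst this
      exact hν (Fin.ext (by have := ν₀.isLt; have := ν₁.isLt; omega))
    rw [hcard, nsmul_eq_mul]
    congr 1
    push_cast [Nat.cast_sub hd1]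
    ring
  rw [hrest]
  -- the ν₀-bonds: `U = 1`, the neighbour has the opposite sign
  rw [piFluxLink_apply_of_ne K hν, piFluxLink_apply_of_ne K hν, conjTranspose_one, Matrix.one_mulVec, Matrix.one_mulVec]
  -- the ν₁-bonds: `U = subSgn·1`, the neighbour is unchanged
  rw [piFluxLink_apply_self, piFluxLink_apply_self, conjTranspose_smul, conjTranspose_one, star_subSgn, smul_one_mulVec_apply, smul_one_mulVec_apply]
  simp only [piTrial, subSgn_add_unitVec_self K hK2, subSgn_sub_unitVec_self K hK2, subSgn_add_unitVec_of_ne K (Ne.symm hν), subSgn_sub_unitVec_of_ne K (Ne.symm hν)]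
  -- algebra with s² = 1 and (√2)² = 2
  have hs : subSgn K (𝕜 := 𝕜) ν₀ x * subSgn K ν₀ x = 1 := subSgn_mul_self K ν₀ x
  have h2 : ((Real.sqrt 2 : ℝ) : 𝕜) * ((Real.sqrt 2 : ℝ) : 𝕜) = 2 := by
    rw [← RCLike.ofReal_mul, Real.mul_self_sqrt (by norm_num)]; norm_cast
  push_cast
  linear_combination (2 * (c : 𝕜) * e i) * h2 - (2 * (c : 𝕜) * e i) * hs

omit [Fintype n] [DecidableEq n] hK in
/-- The trial vector is not zero as soon as `e ≠ 0` (at `x = 0` the coefficient is `2 + √2`). [folklore] -/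
theorem piTrial_ne_zero (ν₀ : Fin (d + 1)) {e : n → 𝕜} (he : e ≠ 0) : piTrial K ν₀ e ≠ 0 := by
  obtain ⟨i, hi⟩ := Function.ne_iff.mp he
  refine Function.ne_iff.mpr ⟨(0, i), ?_⟩
  simp only [piTrial, subSgn, Pi.zero_apply, ZMod.val_zero, pow_zero, ne_eq, mul_eq_zero, not_or]
  refine ⟨?_, hi⟩
  have h : (((1 + Real.sqrt 2 : ℝ)) : 𝕜) + 1 = (((2 + Real.sqrt 2 : ℝ)) : 𝕜) := by push_cast; ring
  rw [h]
  exact_mod_cast (by positivity : (0 : ℝ) < 2 + Real.sqrt 2).ne'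

omit hK in
/-- An explicit eigenvector pins an eigenvalue of a Hermitian matrix: `A v = t·v`, `v ≠ 0`, `t ∈ ℝ` ⟹ `t = λ_i(A)` for some `i`. [folklore] -/
theorem exists_eigenvalues_eq_of_mulVec {ι : Type*} [Fintype ι] [DecidableEq ι] {A : Matrix ι ι 𝕜} (hA : A.IsHermitian) {v : ι → 𝕜} (hv : v ≠ 0) {t : ℝ}
    (h : A *ᵥ v = ((t : ℝ) : 𝕜) • v) : ∃ i, hA.eigenvalues i = t := by
  have hmem : ((t : ℝ) : 𝕜) ∈ spectrum 𝕜 A := by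
    rw [spectrum.mem_iff]
    intro hu
    have hinj := Matrix.mulVec_injective_iff_isUnit.mpr hu
    have h0 : (algebraMap 𝕜 (Matrix ι ι 𝕜) ((t : ℝ) : 𝕜) - A) *ᵥ v = 0 := by
      rw [sub_mulVec, Algebra.algebraMap_eq_smul_one, Matrix.smul_mulVec, one_mulVec, h, sub_self]
    exact hv (hinj (by rw [h0, mulVec_zero]))
  rw [hA.spectrum_eq_image_range] at hmem
  obtain ⟨r, ⟨i, rfl⟩, hr⟩ := hmem
  exact ⟨i, by exact_mod_cast hr⟩

/-- ★★★ **SOME EIGENVALUE EQUALS `m² + (4−2√2)c`** at the π-flux field (non-trivial fibre). [cite: DodziukMathai2006, Cor 1.3 §1; King1986, (4.4) p.670] -/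
theorem exists_eigenvalue_covLapF_piFlux_eq [Nonempty n] (c m2 : ℝ) {ν₀ ν₁ : Fin (d + 1)} (hK2 : Even (K ν₀)) (hν : ν₀ ≠ ν₁) :
    ∃ i, (isHermitian_covLapF K c m2 (piFluxLink K (n := n) (𝕜 := 𝕜) ν₀ ν₁)).eigenvalues i = m2 + (4 - 2 * Real.sqrt 2) * c := by
  classical
  obtain ⟨j⟩ := ‹Nonempty n›
  have he : (Pi.single j (1 : 𝕜) : n → 𝕜) ≠ 0 := Function.ne_iff.mpr ⟨j, by simp⟩
  exact exists_eigenvalues_eq_of_mulVec (isHermitian_covLapF K c m2 _) (piTrial_ne_zero K ν₀ he) (covLapF_piFlux_mulVec_piTrial K c m2 hK2 hν _)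

/-- ★★★ **THE SPECTRAL BOTTOM AT π-FLUX IS EXACTLY `m² + (4−2√2)c`** (`K_{ν₀}` even, `ν₀ ≠ ν₁`, `c ≥ 0`, non-trivial fibre): all eigenvalues are `≥` it and one equals it — the
plaquette coercivity constant `2c·λ(−1)` of PART Ϳ-b is SHARP; the massless covariant Laplacian at maximal abelian curvature has the volume-independent gap `(4−2√2)c`.
[cite: DodziukMathai2006, Cor 1.3 §1; King1986, (4.4) p.670; tHooft1979Flux, NPB 153 (flux sectors, notion)] -/
theorem piFlux_spectral_bottom [Nonempty n] (hc : 0 ≤ c) (m2 : ℝ) {ν₀ ν₁ : Fin (d + 1)} (hK2 : Even (K ν₀)) (hν : ν₀ ≠ ν₁) :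
    (∀ i, m2 + (4 - 2 * Real.sqrt 2) * c ≤ (isHermitian_covLapF K c m2 (piFluxLink K (n := n) (𝕜 := 𝕜) ν₀ ν₁)).eigenvalues i)
      ∧ ∃ i, (isHermitian_covLapF K c m2 (piFluxLink K (n := n) (𝕜 := 𝕜) ν₀ ν₁)).eigenvalues i = m2 + (4 - 2 * Real.sqrt 2) * c :=
  ⟨eigenvalues_covLapF_piFlux_ge K hc m2 hK2 hν, exists_eigenvalue_covLapF_piFlux_eq K c m2 hK2 hν⟩

/-- `4 − 2√2 > 0` (≈ 1.17): the π-flux mass is of the order of the cutoff `c = η⁻²`. [folklore] -/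
theorem four_sub_two_sqrt_two_pos : 0 < 4 - 2 * Real.sqrt 2 := by
  have h : Real.sqrt 2 < 2 := (Real.sqrt_lt' (by norm_num)).mpr (by norm_num)
  linarith

end Attained

end Summit.QuantumFields.YangMills.BalabanUVNodes.N15KingModelRung.Curvature

end
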